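import Mathlib
import Summits.Ventures.PercRepro.TriangleCapTriangleFreeSparseLocus
import Summits.Ventures.PercRepro.TriangleCapEqualityLocusKM

/-!
# PercRepro — THE TRIANGLE-FREE CHERRY TABLE ON EVERY CELL, WITH ITS EQUALITY LOCUS: the `r`-term and nothing
else (p3, gen 42; part 181)

For triangle-free graphs the cherry table has ONE formula on every cell: with `δ(m) = a(k−a)` the least
product `≥ m` and `r = δ(m) − m`, every triangle-free graph on `k` vertices with `m` edges has
`Σ_v d(v)² + r (k − 1 − r) ≤ m k` (`cliqueFree_closed_form`: the row `a ≥ 3` is part 167's closed form through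
`k4mFree_of_cliqueFree`, the row `a = 2` is part 179, the row `a = 1` is the pair count `Σ d² ≤ m (m + 1)`,
the row `a = 0` is empty), with equality iff the graph is `K_{a,k−a}` minus a star of `r` edges at one vertex
(`cliqueFree_closed_form_locus`: part 169 for `a ≥ 3`, part 180 for `a = 2`, and on the row `a = 1` the
equality `Σ_v C(d(v),2) = C(m,2)` means pairwise adjacent edges, which without a triangle is a star through
one vertex — `star_of_pairwiseAdjacent_of_cliqueFree`).  In the table's own coordinates
(`cliqueFree_cherry_table`): for every `k ≥ 1` and `m ≤ k²/4` there are the row `a` and the distance `r`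
with `a(k−a) = m + r` the least product above `m`, and the bound with its locus on every triangle-free
graph with `m` edges.  Unlike the `K₄⁻`-free table (§10aq, §10bp) there is no star regime: the star plus a
matching closes triangles.  Axioms: standard.
-/

namespace PercRepro

namespace TriangleCap

namespace C047

open Finset

variable {V : Type*} [Fintype V] [DecidableEq V]

/-- `2 · C(m, 2) = m (m − 1)`. -/
theorem two_mul_choose_two (m : ℕ) : 2 * m.choose 2 = m * (m - 1) := by
  rw [Nat.choose_two_right]
  exact Nat.two_mul_div_two_of_even (Nat.even_mul_pred_self m)

/-- **THE ROW `a = 1`:** `Σ_v d(v)² + r (k − 1 − r) ≤ m k` when `m + 1 + r = k` — the pair count `Σ d² ≤ m (m + 1)`,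
for every graph. -/
theorem row_one_stability (D : SimpleGraph V) [DecidableRel D.Adj] (r : ℕ)
    (hm : D.edgeFinset.card + 1 * 1 + r = 1 * Fintype.card V) :
    ∑ v, deg D v * deg D v + r * (Fintype.card V - 1 - r) ≤ D.edgeFinset.card * Fintype.card V := by
  have h := sum_deg_mul_deg_le_card_edges D
  have e : Fintype.card V - 1 - r = D.edgeFinset.card := by omega
  rw [e]
  nlinarith [h, hm]

/-- **PAIRWISE ADJACENT EDGES WITHOUT A TRIANGLE PASS THROUGH ONE VERTEX.** -/
theorem star_of_pairwiseAdjacent_of_cliqueFree (D : SimpleGraph V) [DecidableRel D.Adj] (hfree : D.CliqueFree 3)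
    (hpa : PairwiseAdjacent D) (hm : 1 ≤ D.edgeFinset.card) :
    ∃ x, ∀ u w, D.Adj u w → u = x ∨ w = x := by
  obtain ⟨e₀, he₀⟩ := card_pos.mp hm
  revert he₀
  refine Sym2.ind (fun x y he₀ => ?_) e₀
  have hxy : D.Adj x y := by rwa [SimpleGraph.mem_edgeFinset, SimpleGraph.mem_edgeSet] at he₀
  by_cases hx : ∀ u w, D.Adj u w → u = x ∨ w = x
  · exact ⟨x, hx⟩
  · push Not at hx
    obtain ⟨u, w, huw, hux, hwx⟩ := hx
    have hf : s(u, w) ∈ D.edgeFinset := by rwa [SimpleGraph.mem_edgeFinset, SimpleGraph.mem_edgeSet]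
    have hne : s(x, y) ≠ s(u, w) := by
      intro h
      have : x ∈ s(u, w) := h ▸ Sym2.mem_mk_left x y
      rw [Sym2.mem_iff] at this
      rcases this with h1 | h1
      · exact hux h1.symm
      · exact hwx h1.symm
    -- the common vertex of `e₀` and `f` is `y`
    obtain ⟨t, ht₀, htf⟩ := hpa _ he₀ _ hf hne
    rw [Sym2.mem_iff] at ht₀ htf
    have hty : t = y := by
      rcases ht₀ with h | h
      · exfalso
        rcases htf with h1 | h1
        · exact hux (h1.symm.trans h)
        · exact hwx (h1.symm.trans h)
      · exact h
    rw [hty] at htf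
    -- every edge contains `y`
    refine ⟨y, fun p q hpq => ?_⟩
    by_contra hcon
    push Not at hcon
    obtain ⟨hpy, hqy⟩ := hcon
    have hg : s(p, q) ∈ D.edgeFinset := by rwa [SimpleGraph.mem_edgeFinset, SimpleGraph.mem_edgeSet]
    have hne₀ : s(x, y) ≠ s(p, q) := by
      intro h
      have : y ∈ s(p, q) := h ▸ Sym2.mem_mk_right x y
      rw [Sym2.mem_iff] at this
      rcases this with h1 | h1
      · exact hpy h1.symm
      · exact hqy h1.symm
    have hnef : s(u, w) ≠ s(p, q) := by
      intro h
      have : y ∈ s(p, q) := by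
        rw [← h, Sym2.mem_iff]
        exact htf
      rw [Sym2.mem_iff] at this
      rcases this with h1 | h1
      · exact hpy h1.symm
      · exact hqy h1.symm
    obtain ⟨s₁, hs₁, hs₁g⟩ := hpa _ he₀ _ hg hne₀
    obtain ⟨s₂, hs₂, hs₂g⟩ := hpa _ hf _ hg hnef
    rw [Sym2.mem_iff] at hs₁ hs₁g hs₂ hs₂g
    -- `g` meets `e₀` at `x` (not at `y`) and `f` at its end other than `y`
    have hs₁x : s₁ = x := by
      rcases hs₁ with h | h
      · exact h
      · exfalso
        rcases hs₁g with h1 | h1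
        · exact hpy (h1.symm.trans h)
        · exact hqy (h1.symm.trans h)
    have hs₂y : s₂ ≠ y := by
      intro h
      rcases hs₂g with h1 | h1
      · exact hpy (h1.symm.trans h)
      · exact hqy (h1.symm.trans h)
    have hxs₂ : x ≠ s₂ := by
      intro h
      rcases hs₂ with h1 | h1
      · exact hux (h.trans h1).symm
      · exact hwx (h.trans h1).symm
    -- so `g = s(x, s₂)`, and `x y s₂` is a triangle
    have hadj : D.Adj x s₂ := by
      rw [hs₁x] at hs₁g
      rcases hs₁g with h1 | h1 <;> rcases hs₂g with h2 | h2
      · exact absurd (h1.trans h2.symm) hxs₂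
      · rw [h1, h2]
        exact hpq
      · rw [h1, h2]
        exact D.adj_symm hpq
      · exact absurd (h1.trans h2.symm) hxs₂
    have hys₂ : D.Adj y s₂ := by
      rcases htf with h3 | h3 <;> rcases hs₂ with h4 | h4
      · exact absurd (h4.trans h3.symm) hs₂y
      · rw [h4, h3]
        exact huw
      · rw [h4, h3]
        exact D.adj_symm huw
      · exact absurd (h4.trans h3.symm) hs₂y
    exact hfree {x, y, s₂} (SimpleGraph.is3Clique_triple_iff.mpr ⟨hxy, hadj, hys₂⟩)

/-- **THE ROW `a = 1`, THE LOCUS:** with `m + 1 + r = k` and `m ≥ 1`, a triangle-free graph attains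
`Σ_v d(v)² + r (k − 1 − r) = m k` iff all its edges pass through one vertex, i.e. it is `K_{1,k−1}` minus an
`r`-star at the centre. -/
theorem row_one_locus (D : SimpleGraph V) [DecidableRel D.Adj] (hfree : D.CliqueFree 3) (r : ℕ)
    (hk : 2 * 1 + r ≤ Fintype.card V) (hm : D.edgeFinset.card + 1 * 1 + r = 1 * Fintype.card V) :
    ∑ v, deg D v * deg D v + r * (Fintype.card V - 1 - r) = D.edgeFinset.card * Fintype.card V ↔
      ∃ (A : Finset V) (v : V), A.card = 1 ∧ BipSub D A ∧ MissingStar D A v := by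
  have e : Fintype.card V - 1 - r = D.edgeFinset.card := by omega
  have h2 := two_mul_cherries_add D
  have h3 := sum_deg_eq D
  have hc := two_mul_choose_two D.edgeFinset.card
  have hm1 : 1 ≤ D.edgeFinset.card := by omega
  rw [e]
  -- the equality is `cherries D = C(m, 2)`
  have key : ∑ v, deg D v * deg D v + r * D.edgeFinset.card = D.edgeFinset.card * Fintype.card V ↔
      cherries D = (D.edgeFinset.card).choose 2 := by
    constructor
    · intro h
      have : 2 * cherries D = 2 * (D.edgeFinset.card).choose 2 := by
        rw [hc]
        obtain ⟨m', hm'⟩ : ∃ m', D.edgeFinset.card = m' + 1 := ⟨_, (Nat.succ_pred_eq_of_pos hm1).symm⟩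
        rw [hm'] at h h3 hm ⊢
        rw [Nat.add_sub_cancel]
        nlinarith [h, h2, h3, hm]
      omega
    · intro h
      have h4 : 2 * cherries D = D.edgeFinset.card * (D.edgeFinset.card - 1) := by rw [h, hc]
      obtain ⟨m', hm'⟩ : ∃ m', D.edgeFinset.card = m' + 1 := ⟨_, (Nat.succ_pred_eq_of_pos hm1).symm⟩
      rw [hm'] at h4 h3 hm ⊢
      rw [Nat.add_sub_cancel] at h4
      nlinarith [h4, h2, h3, hm]
  rw [key, cherries_eq_choose_two_iff]
  constructor
  · intro hpa
    obtain ⟨x, hx⟩ := star_of_pairwiseAdjacent_of_cliqueFree D hfree hpa hm1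
    refine ⟨{x}, x, card_singleton x, ?_, ?_⟩
    · intro u w huw
      simp only [mem_singleton]
      rcases hx u w huw with h | h
      · subst h
        exact ⟨fun _ => (D.ne_of_adj huw).symm, fun _ => rfl⟩
      · subst h
        exact ⟨fun h1 => absurd h1 (D.ne_of_adj huw), fun h1 => absurd rfl h1⟩
    · intro u w hu _ _
      rw [mem_singleton] at hu
      exact Or.inl hu
  · rintro ⟨A, v, hA, hsub, -⟩
    obtain ⟨x, rfl⟩ := card_eq_one.mp hA
    -- every edge contains `x`: two edges share it
    intro e he f hf _
    refine ⟨x, ?_, ?_⟩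
    · revert he
      refine Sym2.ind (fun u w he => ?_) e
      rw [SimpleGraph.mem_edgeFinset, SimpleGraph.mem_edgeSet] at he
      have := hsub u w he
      simp only [mem_singleton] at this
      rw [Sym2.mem_iff]
      by_cases hu : u = x
      · exact Or.inl hu.symm
      · have hw : w = x := by
          by_contra hw
          exact hu (this.mpr hw)
        exact Or.inr hw.symm
    · revert hf
      refine Sym2.ind (fun u w hf => ?_) f
      rw [SimpleGraph.mem_edgeFinset, SimpleGraph.mem_edgeSet] at hf
      have := hsub u w hf
      simp only [mem_singleton] at this
      rw [Sym2.mem_iff]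
      by_cases hu : u = x
      · exact Or.inl hu.symm
      · have hw : w = x := by
          by_contra hw
          exact hu (this.mpr hw)
        exact Or.inr hw.symm

omit [DecidableEq V] in
/-- **THE ROW `a = 0`:** no edges, every degree `0`. -/
theorem row_zero_deg (D : SimpleGraph V) [DecidableRel D.Adj] (hm : D.edgeFinset.card = 0) (v : V) :
    deg D v = 0 := by
  have hsum := sum_deg_eq D
  rw [hm] at hsum
  have := single_le_sum (fun v _ => Nat.zero_le (deg D v)) (mem_univ v)
  omega

/-- **THE TRIANGLE-FREE CHERRY TABLE ON EVERY CELL, THE BOUND:** a triangle-free graph on `k` vertices with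
`m = a(k−a) − r` edges, `2a + r ≤ k`, has `Σ_v d(v)² + r (k − 1 − r) ≤ m k` — the `r`-term on every row. -/
theorem cliqueFree_closed_form (D : SimpleGraph V) [DecidableRel D.Adj] (hfree : D.CliqueFree 3) (a r : ℕ)
    (hk : 2 * a + r ≤ Fintype.card V) (hm : D.edgeFinset.card + a * a + r = a * Fintype.card V) :
    ∑ v, deg D v * deg D v + r * (Fintype.card V - 1 - r) ≤ D.edgeFinset.card * Fintype.card V := by
  rcases Nat.lt_or_ge a 3 with ha | ha
  · interval_cases a
    · have hm0 : D.edgeFinset.card = 0 := by omega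
      have hr0 : r = 0 := by omega
      subst hr0
      simp only [zero_mul, add_zero, hm0]
      rw [sum_congr rfl (fun v _ => by rw [row_zero_deg D hm0 v])]
      simp
    · exact row_one_stability D r hm
    · exact cliqueFree_sparse_stability D hfree r hk hm
  · exact closed_form_stability D (k4mFree_of_cliqueFree D hfree) a r ha hk hm

/-- **THE TRIANGLE-FREE CHERRY TABLE ON EVERY CELL, THE EQUALITY LOCUS:** equality holds iff the graph is
`K_{a,k−a}` minus a star of `r` edges at one vertex (for `a = 0` every vertex of the edgeless graph is such a
centre, whence `k ≥ 1`). -/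
theorem cliqueFree_closed_form_locus (D : SimpleGraph V) [DecidableRel D.Adj] (hfree : D.CliqueFree 3)
    (a r : ℕ) (hV : 1 ≤ Fintype.card V) (hk : 2 * a + r ≤ Fintype.card V)
    (hm : D.edgeFinset.card + a * a + r = a * Fintype.card V) :
    ∑ v, deg D v * deg D v + r * (Fintype.card V - 1 - r) = D.edgeFinset.card * Fintype.card V ↔
      ∃ (A : Finset V) (v : V), A.card = a ∧ BipSub D A ∧ MissingStar D A v := by
  rcases Nat.lt_or_ge a 3 with ha | ha
  · interval_cases a
    · have hm0 : D.edgeFinset.card = 0 := by omega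
      have hr0 : r = 0 := by omega
      subst hr0
      obtain ⟨v⟩ := Fintype.card_pos_iff.mp hV
      have hno : ∀ x y, ¬ D.Adj x y := by
        intro x y hxy
        have h1 : y ∈ univ.filter (fun w => D.Adj x w) := mem_filter.mpr ⟨mem_univ y, hxy⟩
        have h2 := card_pos.mpr ⟨y, h1⟩
        have h3 := row_zero_deg D hm0 x
        unfold deg at h3
        omega
      constructor
      · intro _
        exact ⟨∅, v, card_empty, fun x y hxy => absurd hxy (hno x y), fun x _ hx => absurd hx (notMem_empty x)⟩
      · intro _
        simp only [zero_mul, add_zero, hm0]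
        rw [sum_congr rfl (fun v _ => by rw [row_zero_deg D hm0 v])]
        simp
    · exact row_one_locus D hfree r hk hm
    · exact cliqueFree_sparse_locus D hfree r hk hm
  · exact closed_form_eq_iff_cliqueFree D hfree a r ha hk hm

/-- The cell of a pair `(k, m)` with `4m ≤ k²`: the row `a` and the distance `r` with `a(k−a) = m + r` the least
product above `m` (`a = 0` at `m = 0`, `a = 1` for `m ≤ k − 1`, `a = 2` for `k ≤ m ≤ 2k − 4`, part 166's cell in
the dense corner). -/
theorem exists_cell_all (k m : ℕ) (hm : 4 * m ≤ k * k) :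
    ∃ a r : ℕ, 2 * a + r ≤ k ∧ a * (k - a) = m + r ∧
      ∀ a' : ℕ, a' ≤ k → m ≤ a' * (k - a') → a * (k - a) ≤ a' * (k - a') := by
  rcases Nat.eq_zero_or_pos m with hm0 | hm1
  · exact ⟨0, 0, by omega, by simp [hm0], fun _ _ _ => by simp⟩
  rcases Nat.lt_or_ge m k with hmk | hmk
  · -- the row `a = 1`
    refine ⟨1, k - 1 - m, by omega, by omega, ?_⟩
    intro a' ha' hma'
    rcases Nat.eq_zero_or_pos a' with h0 | h0
    · subst h0
      simp at hma'
      omega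
    rcases Nat.lt_or_ge a' k with h1 | h1
    · obtain ⟨c, rfl⟩ : ∃ c, k = a' + c := ⟨k - a', by omega⟩
      rw [Nat.add_sub_cancel_left]
      have := mul_ge_add_sub_one a' c h0 (by omega)
      omega
    · have : a' = k := by omega
      subst this
      simp at hma'
      omega
  rcases Nat.lt_or_ge (m + 3) (2 * k) with hm2 | hm2
  · -- the row `a = 2`
    refine ⟨2, 2 * (k - 2) - m, by omega, by omega, ?_⟩
    intro a' ha' hma'
    rcases Nat.lt_or_ge a' 2 with h0 | h0
    · interval_cases a'
      · simp at hma'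
        omega
      · omega
    rcases Nat.lt_or_ge k (a' + 2) with h1 | h1
    · -- `a' ∈ {k − 1, k}`: the product is `≤ k − 1 < m`
      rcases Nat.lt_or_ge a' k with h2 | h2
      · have : a' = k - 1 := by omega
        subst this
        have : k - (k - 1) = 1 := by omega
        rw [this, mul_one] at hma'
        omega
      · have : a' = k := by omega
        subst this
        simp at hma'
        omega
    · obtain ⟨c, rfl⟩ : ∃ c, k = a' + c := ⟨k - a', by omega⟩
      rw [Nat.add_sub_cancel_left]
      obtain ⟨a₂, rfl⟩ : ∃ a₂, a' = a₂ + 2 := ⟨a' - 2, by omega⟩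
      obtain ⟨c₂, rfl⟩ : ∃ c₂, c = c₂ + 2 := ⟨c - 2, by omega⟩
      have e : a₂ + 2 + (c₂ + 2) - 2 = a₂ + c₂ + 2 := by omega
      rw [e]
      nlinarith [Nat.zero_le (a₂ * c₂)]
  · -- the dense corner: `k ≥ 6`
    have hk6 : 6 ≤ k := by nlinarith
    obtain ⟨a, r, ha, hak, hprod⟩ := exists_cell k m hk6 hm2 hm
    exact ⟨a, r, hak, hprod, least_prod_of_cell k a r m ha hak hprod⟩

/-- **THE TRIANGLE-FREE CHERRY TABLE:** for every `k ≥ 1` and `m ≤ k²/4` there are the row `a` and the distance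
`r` with `a(k−a) = m + r` the least product above `m`, and every triangle-free graph on `Fin k` with `m` edges has
`Σ_v d(v)² + r (k − 1 − r) ≤ m k`, with equality iff it is `K_{a,k−a}` minus a star of `r` edges at one vertex. -/
theorem cliqueFree_cherry_table (k m : ℕ) (hk : 1 ≤ k) (hm : 4 * m ≤ k * k) :
    ∃ a r : ℕ, 2 * a + r ≤ k ∧ a * (k - a) = m + r ∧
      (∀ a' : ℕ, a' ≤ k → m ≤ a' * (k - a') → a * (k - a) ≤ a' * (k - a')) ∧
      ∀ (D : SimpleGraph (Fin k)) [DecidableRel D.Adj], D.CliqueFree 3 → D.edgeFinset.card = m →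
        (∑ v, deg D v * deg D v + r * (k - 1 - r) ≤ m * k) ∧
        (∑ v, deg D v * deg D v + r * (k - 1 - r) = m * k ↔
          ∃ (A : Finset (Fin k)) (v : Fin k), A.card = a ∧ BipSub D A ∧ MissingStar D A v) := by
  obtain ⟨a, r, hak, hprod, hleast⟩ := exists_cell_all k m hm
  refine ⟨a, r, hak, hprod, hleast, ?_⟩
  intro D _ hfree hD
  have hcard : Fintype.card (Fin k) = k := Fintype.card_fin k
  have hm' : D.edgeFinset.card + a * a + r = a * Fintype.card (Fin k) := by
    rw [hcard, hD]
    obtain ⟨c, rfl⟩ : ∃ c, k = a + c := ⟨k - a, by omega⟩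
    rw [Nat.add_sub_cancel_left] at hprod
    nlinarith [hprod]
  have h1 := cliqueFree_closed_form D hfree a r (by rw [hcard]; exact hak) hm'
  have h2 := cliqueFree_closed_form_locus D hfree a r (by rw [hcard]; exact hk) (by rw [hcard]; exact hak) hm'
  rw [hcard, hD] at h1 h2
  exact ⟨h1, h2⟩

end C047

end TriangleCap

end PercRepro
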